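import Literature.AlgebraicGeometry.Resolution.QuadraticTransforms
import Literature.AlgebraicGeometry.Resolution.RegularLocalRingsNormal
import Summits.ResolutionOfSingularities.ResolutionOfSingularities.Theorems.ValuativeLuAlphaPTorsorLogPrincipalizationLowDim

/-!
# Non-`p`-th powers persist along quadratic transforms (crux `Valuative.LuAlphaPTorsor`, line `pfaff-line-log-final-forms`)

Helper file for the stub `forall_ne_pow_of_isQuadraticTransformAlong` (U14) of the line
`pfaff-line-log-final-forms` (item `stmt-ResolutionOfSingularities-0641`): the Giraud induction
moves from the regular local ring `R₀` of the base at the centre to its quadratic transforms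
`R₁, R₂, …` inside `K` along the valuation ring `O`, and needs the hypothesis "`a = t^p` is not
a `p`-th power" to persist.

* `le_subfieldClosure_of_isQuadraticTransformAlong` — a quadratic transform `R₁` of `R ⊆ K`
  along `O` lies in the subfield of `K` generated by `R`: `R₁ = (R[𝔪/x])_{𝔪_O ∩ R[𝔪/x]}`
  (`IsQuadraticTransformAlong.exists_eq_locAtCentre`) consists of fractions of elements of
  `R[𝔪/x]`, itself generated by `R` and the fractions `y/x`.
* `forall_ne_pow_of_isQuadraticTransformAlong` — if `R` is moreover regular (hence an
  integrally closed domain, Matsumura Thm. 19.4) and `a ∈ R` is not a `p`-th power in `R`, it is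
  not a `p`-th power in `R₁`: a `p`-th root `c = a'/b'` (`a', b' ∈ R`) gives the `p`-th root
  `a'/b'` of `a` in `Frac R`, which lies in `R` by normality
  (`not_exists_pow_eq_algebraMap_of_forall_ne_pow`). Note that `K` need not be the fraction
  field of `R`.
-/

set_option linter.dupNamespace false

noncomputable section

open IsLocalRing Literature.AlgebraicGeometry.Resolution

namespace Summit.ResolutionOfSingularities.ResolutionOfSingularities.Theorems.PfaffLine

section NePow

variable {K : Type*} [Field K]

/-- A quadratic transform `R₁` of `R ⊆ K` along `O` lies in the subfield of `K` generated by
`R`: every element of `R₁ = (R[𝔪/x])_{𝔪_O ∩ R[𝔪/x]}` is a fraction of elements of `R`.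
[folklore] -/
theorem le_subfieldClosure_of_isQuadraticTransformAlong {O : ValuationSubring K}
    {R R₁ : Subring K} (h : IsQuadraticTransformAlong O R R₁) :
    R₁ ≤ (Subfield.closure (R : Set K)).toSubring := by
  obtain ⟨_, x, -, -, -, rfl⟩ := h.exists_eq_locAtCentre
  have hB : blowupRing R ((x : R) : K) ≤ (Subfield.closure (R : Set K)).toSubring := by
    refine Subring.closure_le.mpr ?_
    rintro z (hz | ⟨y, -, rfl⟩)
    · exact Subfield.subset_closure hz
    · show ((y : R) : K) / x ∈ Subfield.closure (R : Set K)
      exact div_mem (Subfield.subset_closure y.2) (Subfield.subset_closure x.2)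
  rintro z ⟨u, hu, v, hv, -, rfl⟩
  show u / v ∈ Subfield.closure (R : Set K)
  exact div_mem (hB hu) (hB hv)

/-- Elements of the subfield of `K` generated by a subring `R` are fractions `a / b` with
`a, b ∈ R`, `b ≠ 0`. [folklore] -/
theorem exists_eq_div_of_mem_subfieldClosure {R : Subring K} {z : K}
    (hz : z ∈ Subfield.closure (R : Set K)) : ∃ a ∈ R, ∃ b ∈ R, b ≠ 0 ∧ z = a / b := by
  rw [Subfield.mem_closure_iff, Subring.closure_eq] at hz
  obtain ⟨a, ha, b, hb, rfl⟩ := hz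
  by_cases hb0 : b = 0
  · exact ⟨0, R.zero_mem, 1, R.one_mem, one_ne_zero, by simp [hb0]⟩
  · exact ⟨a, ha, b, hb, hb0, rfl⟩

end NePow

/-- **Non-`p`-th powers persist along quadratic transforms.** Let `R ⊆ K` be a regular local
subring, `R₁` its quadratic transform along the valuation ring `O`, and `a ∈ R` not a `p`-th
power in `R`. Then `a` is not a `p`-th power in `R₁`: every element of `R₁` is a fraction
`a'/b'` of elements of `R`, and a `p`-th root `a'/b'` of `a` in `Frac R` lies in the integrally
closed domain `R` (Matsumura Thm. 19.4). [folklore] -/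
theorem forall_ne_pow_of_isQuadraticTransformAlong : ∀ {K : Type} [Field K] (O : ValuationSubring K) (R R₁ : Subring K) [IsRegularLocalRing R] (h : Literature.AlgebraicGeometry.Resolution.IsQuadraticTransformAlong O R R₁) (p : ℕ) (a : R), (∀ c : R, a ≠ c ^ p) → ∀ c : R₁, Subring.inclusion h.le a ≠ c ^ p := by
  intro K _ O R R₁ _ h p a ha c hc
  -- read the equation in `K`
  have hcK : ((a : R) : K) = (c : K) ^ p := by
    have e := congrArg Subtype.val hc
    rwa [Subring.coe_inclusion, Subring.coe_pow] at e
  rcases Nat.eq_zero_or_pos p with rfl | hp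
  · refine ha 1 (Subtype.ext ?_)
    rw [pow_zero] at hcK ⊢
    rw [hcK, OneMemClass.coe_one]
  -- `c = a' / b'` with `a', b' ∈ R`, `b' ≠ 0`
  obtain ⟨a', ha', b', hb', hb0, hcab⟩ :=
    exists_eq_div_of_mem_subfieldClosure (le_subfieldClosure_of_isQuadraticTransformAlong h c.2)
  -- the relation `a' ^ p = a * b' ^ p` in `R`
  have hrel : (⟨a', ha'⟩ : R) ^ p = a * ⟨b', hb'⟩ ^ p := by
    apply Subtype.ext
    rw [Subring.coe_pow, Subring.coe_mul, Subring.coe_pow]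
    change a' ^ p = (a : K) * b' ^ p
    rw [hcK, hcab, div_pow, div_mul_cancel₀ _ (pow_ne_zero _ hb0)]
  -- pass to the fraction field of the integrally closed domain `R`
  haveI := isIntegrallyClosed_of_isRegularLocalRing R
  have hbR : (⟨b', hb'⟩ : R) ≠ 0 := fun e => hb0 (congrArg Subtype.val e)
  have hbL : algebraMap R (FractionRing R) ⟨b', hb'⟩ ≠ 0 := fun e =>
    hbR (IsFractionRing.to_map_eq_zero_iff.mp e)
  refine not_exists_pow_eq_algebraMap_of_forall_ne_pow hp.ne' ha
    (algebraMap R (FractionRing R) ⟨a', ha'⟩ / algebraMap R (FractionRing R) ⟨b', hb'⟩) ?_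
  rw [div_pow, ← map_pow, hrel, map_mul, map_pow, mul_div_assoc, div_self (pow_ne_zero _ hbL),
    mul_one]

end Summit.ResolutionOfSingularities.ResolutionOfSingularities.Theorems.PfaffLine
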